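import Summits.BirchSwinnertonDyer.BirchSwinnertonDyer.Theorems.ErratumRoadFiveIMCDivMemberCongruenceErratumTame
import Summits.BirchSwinnertonDyer.BirchSwinnertonDyer.Theorems.UniversalToricDescentReceptacleUntwist
import Summits.BirchSwinnertonDyer.BirchSwinnertonDyer.Theorems.UniversalToricDescentRoadFFMemberSaturation
import HarnessLib

/-!
# The member receptacle `R₀ ⊗_{ℤ_p} 𝒪`: `p` is a non-zero-divisor and `(R₀ ⊗ 𝒪)/(p)` is Artinian
# (the two instance facts of the member-level untwisting, memo `MEMBER-UNTWIST-RECEPTACLE-DESIGN-w2g3.md`)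

Width seat `bsd-wall-utd-p2-w2` (g3), for membertower v9 on ♭B′ stmt-BirchSwinnertonDyer-27401. `--supports stmt-BirchSwinnertonDyer-20694`.
With `CongruenceDescent.regular_C_of_isUnit_coeff_mod` (sibling file `UniversalToricDescentReceptacleUntwist.lean`) these give:
in the receptacle `(R₀ ⊗_{ℤ_p} 𝒪_m)⟦T⟧` of the descent kernels (p616714 / p624148 / p625404), `C p` is regular modulo every `L_m`
having a coefficient that is a unit modulo `p` — so a rational member inclusion `p^e·Ch ⊆ (L_m)` with `μ(L_m) = 0` untwists to
`Ch ⊆ (L_m)` (`CongruenceDescent.mem_span_of_pow_mul_mem_span`). Pure algebra; nothing about BSD is asserted.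

* (`p·s = 0 ⟹ s = 0` in `R₀ ⊗ 𝒪` for `𝒪` free is the tree's `RoadFFSaturation.eq_zero_of_natCast_p_mul_eq_zero_receptacle`, reused.)
* `isArtinianRing_receptacle_quotient` — `𝒪` module-finite over `ℤ_p`: `(R₀ ⊗ 𝒪) ⧸ (p)` is Artinian (a homomorphic image of
  `(R₀/p) ⊗_{ℤ_p} 𝒪`, which is module-finite over the field `R₀/p`).
* `receptacle_regular_C_of_isUnit_coeff_mod` — the untwisting statement in the receptacle.

References: [AtiyahMacdonald1969] Prop. 8.4, Ch. 2 (tensor products, base change); [Castella2018] §3 (p. 9) (`R₀`).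
-/

set_option autoImplicit false

noncomputable section

open scoped TensorProduct

namespace Summit.BirchSwinnertonDyer.Rank1Residual.X11b.RoadFFMember

open PowerSeries Literature.NumberTheory.EllipticCurves Summit.BirchSwinnertonDyer.Rank1Residual.X2

section Receptacle

variable (p : ℕ) [Fact p.Prime] [Algebra ℤ_[p] (unrIntegers p)]
  (𝒪 : Type) [CommRing 𝒪] [Algebra ℤ_[p] 𝒪]

set_option maxHeartbeats 800000 in
/-- **`(R₀ ⊗_{ℤ_p} 𝒪) ⧸ (p)` is Artinian** for `𝒪` module-finite over `ℤ_p`: it is a homomorphic image of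
`(R₀/p) ⊗_{ℤ_p} 𝒪`, a module-finite algebra over the field `R₀/p`. [cite: AtiyahMacdonald1969, Prop. 8.4 and Ch. 2] -/
theorem isArtinianRing_receptacle_quotient [Module.Finite ℤ_[p] 𝒪] :
    IsArtinianRing ((unrIntegers p ⊗[ℤ_[p]] 𝒪) ⧸ Ideal.span {((p : ℕ) : unrIntegers p ⊗[ℤ_[p]] 𝒪)}) := by
  haveI := HidaLimitAlgebra.isDiscreteValuationRing_unrIntegers (p := p)
  -- `R₀/p` is a field
  set I : Ideal (unrIntegers p) := Ideal.span {((p : ℕ) : unrIntegers p)} with hI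
  haveI hImax : I.IsMaximal := by
    rw [hI, ← (IsDiscreteValuationRing.irreducible_iff_uniformizer _).mp
      (HidaLimitAlgebra.irreducible_natCast_p (p := p))]
    exact IsLocalRing.maximalIdeal.isMaximal (unrIntegers p)
  letI : Field (unrIntegers p ⧸ I) := Ideal.Quotient.field I
  -- the Artinian ring `T = (R₀/p) ⊗ 𝒪`
  haveI : IsArtinianRing ((unrIntegers p ⧸ I) ⊗[ℤ_[p]] 𝒪) :=
    IsArtinianRing.of_finite (unrIntegers p ⧸ I) ((unrIntegers p ⧸ I) ⊗[ℤ_[p]] 𝒪)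
  -- the surjection `T → (R₀ ⊗ 𝒪)/(p)`
  set J : Ideal (unrIntegers p ⊗[ℤ_[p]] 𝒪) := Ideal.span {((p : ℕ) : unrIntegers p ⊗[ℤ_[p]] 𝒪)} with hJ
  have hIJ : I ≤ J.comap (Algebra.TensorProduct.includeLeft (S := ℤ_[p]) (R := ℤ_[p]) (A := unrIntegers p) (B := 𝒪)) := by
    rw [hI, Ideal.span_le, Set.singleton_subset_iff, SetLike.mem_coe, Ideal.mem_comap, map_natCast, hJ]
    exact Ideal.mem_span_singleton_self _
  have hkill : ∀ a ∈ I, ((Ideal.Quotient.mkₐ ℤ_[p] J).comp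
      (Algebra.TensorProduct.includeLeft (S := ℤ_[p]) (R := ℤ_[p]) (A := unrIntegers p) (B := 𝒪))) a = 0 := by
    intro a ha
    rw [hI, Ideal.mem_span_singleton'] at ha
    obtain ⟨c, rfl⟩ := ha
    rw [AlgHom.comp_apply, Ideal.Quotient.mkₐ_eq_mk, Ideal.Quotient.eq_zero_iff_mem, map_mul, map_natCast, hJ]
    exact Ideal.mul_mem_left _ _ (Ideal.mem_span_singleton_self _)
  set f : (unrIntegers p ⧸ I) →ₐ[ℤ_[p]] (unrIntegers p ⊗[ℤ_[p]] 𝒪) ⧸ J :=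
    Ideal.Quotient.liftₐ I ((Ideal.Quotient.mkₐ ℤ_[p] J).comp
      (Algebra.TensorProduct.includeLeft (S := ℤ_[p]) (R := ℤ_[p]) (A := unrIntegers p) (B := 𝒪))) hkill with hf
  set g : 𝒪 →ₐ[ℤ_[p]] (unrIntegers p ⊗[ℤ_[p]] 𝒪) ⧸ J :=
    (Ideal.Quotient.mkₐ ℤ_[p] J).comp (Algebra.TensorProduct.includeRight (R := ℤ_[p]) (A := unrIntegers p) (B := 𝒪))
    with hg
  have hfa : ∀ a : unrIntegers p, f (Ideal.Quotient.mk I a) = Ideal.Quotient.mk J (a ⊗ₜ[ℤ_[p]] (1 : 𝒪)) := by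
    intro a
    rw [hf, Ideal.Quotient.liftₐ_apply, Ideal.Quotient.lift_mk]
    rfl
  have hgb : ∀ b : 𝒪, g b = Ideal.Quotient.mk J ((1 : unrIntegers p) ⊗ₜ[ℤ_[p]] b) := fun b ↦ rfl
  set φ := Algebra.TensorProduct.lift f g (fun x y ↦ mul_comm (f x) (g y)) with hφ
  refine Function.Surjective.isArtinianRing (f := φ) ?_
  intro x
  obtain ⟨s, rfl⟩ := Ideal.Quotient.mk_surjective x
  induction s using TensorProduct.induction_on with
  | zero => exact ⟨0, by rw [map_zero, map_zero]⟩
  | tmul a b =>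
      refine ⟨Ideal.Quotient.mk I a ⊗ₜ b, ?_⟩
      rw [hφ, Algebra.TensorProduct.lift_tmul, hfa, hgb, ← map_mul, Algebra.TensorProduct.tmul_mul_tmul, mul_one, one_mul]
  | add x y hx hy =>
      obtain ⟨u, hu⟩ := hx
      obtain ⟨v, hv⟩ := hy
      refine ⟨u + v, ?_⟩
      rw [map_add φ u v, hu, hv, ← map_add (Ideal.Quotient.mk J) x y]

/-- **Untwisting in the receptacle.** `𝒪` finite free over `ℤ_p`, `L ∈ (R₀ ⊗ 𝒪)⟦T⟧` with a coefficient that is a unit modulo `p`: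
then `C p · y ∈ (L) ⟹ y ∈ (L)` in `(R₀ ⊗ 𝒪)⟦T⟧`. [cite: AtiyahMacdonald1969, Prop. 8.4] -/
theorem receptacle_regular_C_of_isUnit_coeff_mod [Module.Free ℤ_[p] 𝒪] [Module.Finite ℤ_[p] 𝒪]
    (L : PowerSeries (unrIntegers p ⊗[ℤ_[p]] 𝒪))
    (hL : ∃ i, IsUnit (Ideal.Quotient.mk (Ideal.span {((p : ℕ) : unrIntegers p ⊗[ℤ_[p]] 𝒪)}) (PowerSeries.coeff i L))) :
    ∀ y : PowerSeries (unrIntegers p ⊗[ℤ_[p]] 𝒪),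
      PowerSeries.C ((p : ℕ) : unrIntegers p ⊗[ℤ_[p]] 𝒪) * y ∈ Ideal.span {L} → y ∈ Ideal.span {L} := by
  haveI := isArtinianRing_receptacle_quotient p 𝒪
  exact CongruenceDescent.regular_C_of_isUnit_coeff_mod _ (RoadFFSaturation.eq_zero_of_natCast_p_mul_eq_zero_receptacle p 𝒪) L hL

end Receptacle

end Summit.BirchSwinnertonDyer.Rank1Residual.X11b.RoadFFMember

end
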